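import Summits.QuantumFields.QCD.Theorems.GapBuysCauchyRateRotationRestorationDefs
import Literature.MathematicalPhysics.QuantumFieldTheory.QCDObservableAxisPermutation
import Literature.MathematicalPhysics.QuantumFieldTheory.WilsonAxisSymmetry
import HarnessLib

/-!
# Stub `stub_latticePermCovariance : LatticePermCovariance` (S1a of line `registered`, reshape r1, crux
stmt-QuantumFields-8840 `RotationRestoration`) — PROVED

Exact covariance of the honest lattice QCD `n`-point functions `qcdLatticeSchwinger sch k n σ f` under a
permutation `π` of the four Euclidean axes admitting a `γ₅`-preserving spinor intertwiner `(S, S')`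
(`S γ_μ S' = γ_{π μ}`, `S S' = 1`, `S γ₅ S' = γ₅`), at EVERY cutoff `k`:
`⟨∏ᵢ Φ^{σᵢ}(fᵢ ∘ P_π⁻¹)⟩_k = ⟨∏ᵢ Φ^{σᵢ}(fᵢ)⟩_k`.

Proof (pure lattice bookkeeping, no limits, no integrability):
* `qcdLatticeSchwinger sch k n σ f` is by `rfl` the honest signed functional `qcdTorusExpect` of the ordered
  product of the smeared insertions, and the tree's `qcdTorusExpect_quarkAxisPerm` gives
  `⟨(π,S)·X(π⁻¹·U)⟩ = ⟨X⟩` for every Grassmann-valued `X` (an identity of possibly-junk quotients);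
* `quarkAxisPerm π S S'` is an algebra homomorphism; on the generators it is
  `ψ̄_{f,y,a,α} ↦ ∑_m S_{mα} ψ̄_{f,πy,a,m}`, `ψ_{g,y,a,β} ↦ ∑_m S'_{βm} ψ_{g,πy,a,m}`
  (`quarkAxisPerm_qbar`, `quarkAxisPerm_q`), so the pseudoscalar bilinear `P_{fg}(y) = ψ̄_f (iγ₅) ψ_g (y)` goes to
  `ψ̄_f (i Sγ₅S') ψ_g (πy) = P_{fg}(π y)` by `S γ₅ S' = γ₅` (`quarkAxisPerm_pseudoscalarBilinear`); the glue
  density (a scalar) at `x` read on the lift of `π⁻¹·U` is the density at `π x` read on the lift of `U`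
  (`actionDensity_configPermZd`, `configPermZd_torusLift`, `configPermZd_configShift`); the counterterms
  `shift_s(k)` are scalars (`AlgHom.commutes`) — `quarkAxisPerm_insertion`;
* the site sum over the `π`-invariant cube `box 4 L_k` is re-indexed by `sitePermZd π`
  (`sitePermZd_mem_box_iff`) and `f(a_k • π⁻¹ y) = (f ∘ P_π⁻¹)(a_k • y)` (`piLpCongrLeft_symm_smul_siteToE`,
  `linActTest_apply`) — `quarkAxisPerm_smearedInsertion`.
Model: the Yang–Mills twin `ParabolicTrajectoryContinuumLimitOnTrajectoryStubAxisSymmetry`.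
References: Montvay–Münster 1994 §4.2, App. A (hypercubic group on Dirac spinors); Osterwalder–Seiler 1978 §2.
-/

noncomputable section

namespace Summit.QuantumFields.QCD.Cruxes.RotationRestoration.Birth

open scoped BigOperators SchwartzMap Matrix
open MeasureTheory
open Literature.MathematicalPhysics.QuantumLattice Literature.MathematicalPhysics.AQFT
  Literature.MathematicalPhysics.QuantumFieldTheory Literature.Probability.LatticeModels GrassmannAlgebra

namespace LatticePermCovariance

section Generators

variable {Nf L : ℕ} [NeZero L]

/-- **Image of `ψ̄` under the axis permutation**: `ψ̄_{f,y,a,α} ↦ ∑_m S_{mα} ψ̄_{f,πy,a,m}`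
(spin block substitution, then site relabelling). -/
theorem quarkAxisPerm_qbar (π : Equiv.Perm (Fin 4)) (S S' : Matrix (Fin 4) (Fin 4) ℂ) (f : Fin Nf)
    (y : TorusSite 4 L) (a : Fin 3) (α : Fin 4) :
    quarkAxisPerm Nf π S S' (qbar (f, (y, a, α))) =
      ∑ m : Fin 4, S m α • qbar (Nf := Nf) (f, (sitePerm π y, a, m)) := by
  rw [quarkAxisPerm, AlgHom.comp_apply, qbar, map_blockSubst_psiBar, sum_spinBlock_col_smul, map_sum]
  refine Finset.sum_congr rfl fun m _ => ?_
  rw [map_smul, psiBar, map_funLeft_gen]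
  congr 1
  change psiBar ℂ (quarkSitePerm Nf π (quarkEquiv (f, (y, a, m)))) = _
  rw [quarkSitePerm_quarkEquiv]
  rfl

/-- **Image of `ψ` under the axis permutation**: `ψ_{g,y,a,β} ↦ ∑_m S'_{βm} ψ_{g,πy,a,m}`. -/
theorem quarkAxisPerm_q (π : Equiv.Perm (Fin 4)) (S S' : Matrix (Fin 4) (Fin 4) ℂ) (g : Fin Nf)
    (y : TorusSite 4 L) (a : Fin 3) (β : Fin 4) :
    quarkAxisPerm Nf π S S' (q (g, (y, a, β))) =
      ∑ m : Fin 4, S' β m • q (Nf := Nf) (g, (sitePerm π y, a, m)) := by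
  rw [quarkAxisPerm, AlgHom.comp_apply, q, map_blockSubst_psi]
  simp only [Matrix.transpose_apply]
  rw [sum_spinBlock_row_smul, map_sum]
  refine Finset.sum_congr rfl fun m _ => ?_
  rw [map_smul, psi, map_funLeft_gen]
  congr 1
  change psi ℂ (quarkSitePerm Nf π (quarkEquiv (g, (y, a, m)))) = _
  rw [quarkSitePerm_quarkEquiv]
  rfl

/-- Reversing the order of a fourfold finite sum. -/
theorem sum4_rev {A : Type*} [AddCommMonoid A] (F : Fin 4 → Fin 4 → Fin 4 → Fin 4 → A) :
    ∑ a, ∑ b, ∑ c, ∑ d, F a b c d = ∑ d, ∑ c, ∑ b, ∑ a, F a b c d :=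
  calc ∑ a, ∑ b, ∑ c, ∑ d, F a b c d
      = ∑ a, ∑ b, ∑ d, ∑ c, F a b c d :=
        Finset.sum_congr rfl fun _ _ => Finset.sum_congr rfl fun _ _ => Finset.sum_comm
    _ = ∑ a, ∑ d, ∑ b, ∑ c, F a b c d := Finset.sum_congr rfl fun _ _ => Finset.sum_comm
    _ = ∑ d, ∑ a, ∑ b, ∑ c, F a b c d := Finset.sum_comm
    _ = ∑ d, ∑ a, ∑ c, ∑ b, F a b c d :=
        Finset.sum_congr rfl fun _ _ => Finset.sum_congr rfl fun _ _ => Finset.sum_comm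
    _ = ∑ d, ∑ c, ∑ a, ∑ b, F a b c d := Finset.sum_congr rfl fun _ _ => Finset.sum_comm
    _ = ∑ d, ∑ c, ∑ b, ∑ a, F a b c d :=
        Finset.sum_congr rfl fun _ _ => Finset.sum_congr rfl fun _ _ => Finset.sum_comm

/-- **Conjugating a bilinear**: substituting `Y'_α = ∑_m S_{mα} Y_m`, `Z'_β = ∑_{m'} S'_{βm'} Z_{m'}` into
`∑_{αβ} M_{αβ} Y'_α Z'_β` gives `∑_{m m'} (S M S')_{m m'} Y_m Z_{m'}`. -/
theorem sum_smul_conj_bilinear {A : Type*} [Ring A] [Algebra ℂ A] (M S S' : Matrix (Fin 4) (Fin 4) ℂ)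
    (Y Z : Fin 4 → A) :
    ∑ α, ∑ β, M α β • ((∑ m, S m α • Y m) * ∑ m', S' β m' • Z m') =
      ∑ m, ∑ m', (S * M * S') m m' • (Y m * Z m') := by
  simp only [Finset.sum_mul, Finset.mul_sum, smul_mul_assoc, mul_smul_comm, smul_smul, Finset.smul_sum,
    Matrix.mul_apply, Finset.sum_smul]
  -- LHS `∑ α β m' m`, RHS `∑ m m' β α`
  rw [sum4_rev]
  refine Finset.sum_congr rfl fun m _ => Finset.sum_congr rfl fun m' _ => Finset.sum_congr rfl fun β _ =>
    Finset.sum_congr rfl fun α _ => ?_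
  congr 1
  ring

/-- **The pseudoscalar bilinear is carried to the permuted site** when `S γ₅ S' = γ₅`:
`(π,S) · P_{fg}(y) = P_{fg}(π y)`. -/
theorem quarkAxisPerm_pseudoscalarBilinear {π : Equiv.Perm (Fin 4)} {S S' : Matrix (Fin 4) (Fin 4) ℂ}
    (hγ : S * gammaFive * S' = gammaFive) (f g : Fin Nf) (y : TorusSite 4 L) :
    quarkAxisPerm Nf π S S' (pseudoscalarBilinear f g y) = pseudoscalarBilinear f g (sitePerm π y) := by
  unfold pseudoscalarBilinear
  simp only [map_sum, map_smul, map_mul, quarkAxisPerm_qbar, quarkAxisPerm_q]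
  refine Finset.sum_congr rfl fun a _ => ?_
  have key := sum_smul_conj_bilinear (Complex.I • gammaFive) S S'
    (fun m => qbar (Nf := Nf) (f, (sitePerm π y, a, m))) (fun m => q (Nf := Nf) (g, (sitePerm π y, a, m)))
  rw [Matrix.mul_smul, Matrix.smul_mul, hγ] at key
  simpa only [Matrix.smul_apply, smul_eq_mul] using key

/-- **The species insertions are carried to the permuted site**: `(π,S) · O_s[U](x) = O_s[π·U](π x)` — the
glue density is a scalar invariant under the permutation of the six planes (`actionDensity_configPermZd`,
read through `configPermZd_torusLift`, `configPermZd_configShift`), the pseudoscalar species by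
`quarkAxisPerm_pseudoscalarBilinear` and `sitePerm_proj`. -/
theorem quarkAxisPerm_insertion {π : Equiv.Perm (Fin 4)} {S S' : Matrix (Fin 4) (Fin 4) ℂ}
    (hγ : S * gammaFive * S' = gammaFive) (U : GaugeConfig 4 L (Matrix.specialUnitaryGroup (Fin 3) ℂ))
    (s : QCDField Nf) (x : _root_.Literature.Probability.LatticeModels.Site 4) :
    quarkAxisPerm Nf π S S' (insertion U s x) = insertion (configPerm π U) s (sitePermZd π x) := by
  cases s with
  | glue =>
    simp only [insertion, AlgHom.commutes]
    rw [← configPermZd_torusLift, ← sitePermZd_neg, ← configPermZd_configShift,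
      actionDensity_configPermZd _ (continuous_fundamentalRep (Fin 3))]
  | pseudoRe f g =>
    simp only [insertion, map_smul, map_add, quarkAxisPerm_pseudoscalarBilinear hγ, sitePerm_proj]
  | pseudoIm f g =>
    simp only [insertion, map_smul, map_sub, quarkAxisPerm_pseudoscalarBilinear hγ, sitePerm_proj]

end Generators

section Smeared

variable {Nf : ℕ}

/-- The inverse axis permutation of an embedded lattice point: `P_π⁻¹ y = π⁻¹ y` on `ℤ⁴ ⊂ ℝ⁴`
(`piLpCongrLeft_symm_smul_siteToE` at scale `1`). -/
theorem axisPerm_symm_siteToE (π : Equiv.Perm (Fin 4)) (y : _root_.Literature.Probability.LatticeModels.Site 4) :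
    (axisPerm π).symm (siteToE y) = siteToE (sitePermZd π.symm y) := by
  simpa only [one_smul] using piLpCongrLeft_symm_smul_siteToE π (1 : ℝ) y

/-- **The smeared insertion of the inversely permuted field is the smeared insertion on the permuted test
function**: `(π,S) · Φ_k^s[π⁻¹·U](f) = Φ_k^s[U](f ∘ P_π⁻¹)` — re-index the site sum over the `π`-invariant
cube (`sitePermZd_mem_box_iff`) and use `P_π⁻¹ (a • y) = a • π⁻¹ y` (`piLpCongrLeft_symm_smul_siteToE`). -/
theorem quarkAxisPerm_smearedInsertion {π : Equiv.Perm (Fin 4)} {S S' : Matrix (Fin 4) (Fin 4) ℂ}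
    (hγ : S * gammaFive * S' = gammaFive) (sch : QCDScheme Nf) (k : ℕ)
    (U : GaugeConfig 4 (sch.side k) (Matrix.specialUnitaryGroup (Fin 3) ℂ)) (s : QCDField Nf)
    (f : 𝓢(EuclideanSpace ℝ (Fin 4), ℝ)) :
    quarkAxisPerm Nf π S S' (smearedInsertion sch k (configPerm π.symm U) s f) =
      smearedInsertion sch k U s (linActTest (𝕜 := ℝ) (axisPerm π) f) := by
  unfold smearedInsertion
  rw [map_sum]
  simp only [map_smul, map_sub, AlgHom.commutes, quarkAxisPerm_insertion hγ, configPerm_configPerm_symm,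
    linActTest_apply, axisPerm_symm_siteToE]
  refine Finset.sum_nbij' (sitePermZd π) (sitePermZd π.symm)
    (fun x hx => (sitePermZd_mem_box_iff π _ x).2 hx) (fun x hx => (sitePermZd_mem_box_iff π.symm _ x).2 hx)
    (fun x _ => sitePermZd_symm_apply_apply π x) (fun x _ => sitePermZd_apply_symm_apply π x) fun x _ => ?_
  rw [sitePermZd_symm_apply_apply]

/-- The ordered product of smeared insertions under the axis permutation. -/
theorem quarkAxisPerm_prod_smearedInsertion {π : Equiv.Perm (Fin 4)} {S S' : Matrix (Fin 4) (Fin 4) ℂ}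
    (hγ : S * gammaFive * S' = gammaFive) (sch : QCDScheme Nf) (k : ℕ)
    (U : GaugeConfig 4 (sch.side k) (Matrix.specialUnitaryGroup (Fin 3) ℂ)) {n : ℕ} (σ : Fin n → QCDField Nf)
    (f : Fin n → 𝓢(EuclideanSpace ℝ (Fin 4), ℝ)) :
    quarkAxisPerm Nf π S S'
        ((List.ofFn fun i => smearedInsertion sch k (configPerm π.symm U) (σ i) (f i)).prod) =
      (List.ofFn fun i => smearedInsertion sch k U (σ i) (linActTest (𝕜 := ℝ) (axisPerm π) (f i))).prod := by
  rw [map_list_prod, List.map_ofFn]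
  simp only [Function.comp_def, quarkAxisPerm_smearedInsertion hγ]

/-- `qcdLatticeSchwinger` is the honest functional `qcdTorusExpect` of the ordered product of the smeared
insertions (definitional). -/
theorem qcdLatticeSchwinger_eq_qcdTorusExpect (sch : QCDScheme Nf) (k n : ℕ) (σ : Fin n → QCDField Nf)
    (f : Fin n → 𝓢(EuclideanSpace ℝ (Fin 4), ℝ)) :
    qcdLatticeSchwinger sch k n σ f = qcdTorusExpect (sch.β k) (sch.side k) (fun fl => sch.mq fl k)
      (fun U => (List.ofFn fun i => smearedInsertion sch k U (σ i) (f i)).prod) :=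
  rfl

end Smeared

end LatticePermCovariance

/-- **Registered stub `stub_latticePermCovariance` (S1a) — exact covariance of the lattice `n`-point
functions under an axis permutation with a `γ₅`-preserving spinor intertwiner (PROVED lattice
bookkeeping)**: apply the tree's covariance of the honest functional `qcdTorusExpect_quarkAxisPerm` to the
ordered product of smeared insertions and compute the transformed product
(`LatticePermCovariance.quarkAxisPerm_prod_smearedInsertion`; the proof parts live in the
sub-namespace `LatticePermCovariance`). -/
theorem stub_latticePermCovariance : LatticePermCovariance := by
  intro Nf sch k π Sm Sm' hS hγ n σ f
  rw [LatticePermCovariance.qcdLatticeSchwinger_eq_qcdTorusExpect,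
    LatticePermCovariance.qcdLatticeSchwinger_eq_qcdTorusExpect,
    ← qcdTorusExpect_quarkAxisPerm hS (sch.β k) (fun fl => sch.mq fl k)
      (fun U => (List.ofFn fun i => smearedInsertion sch k U (σ i) (f i)).prod)]
  simp only [LatticePermCovariance.quarkAxisPerm_prod_smearedInsertion hγ]

end Summit.QuantumFields.QCD.Cruxes.RotationRestoration.Birth

end
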